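import Summits.Ventures.PercRepro.C041TreeClosure

/-!
# THE TRIANGLE WITH TWO EXITS — the block map of the triangle on six-vectors, its identity, and cone membership
when every type state of the hanging zones is invalid (mine-3, gen 58; C-041.md §21)

Vocabulary of `C041TreeClosure` (namespace `PercRepro.TreeClosure`): six-vectors `Vec6 = Fin 6 → ℝ`,
`(L₀, L₁, L₂, M₀, M₁, M₂) = (F, F + T₁, F + T₂, I_F, I_F + I₁, I_F + I₂)` of a one-anchor zone, the pure vectors
`V a = ∏ v (a i)`, the cone `InCone` they generate, `ell g t1 t2 k` (the six-vector of a zone hung by one edge) and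
`K4v w` (the invariant (P) of `ψ w`).  THE TRIANGLE `a – u – u′ – a` with zones of six-vectors `w` (at `u`) and
`w′` (at `u′`): for each of the eight colourings of its edges the hanging zones contribute the product of per-exit
vectors — `thB w = (L₀, L₁, L₂, L₀, L₁, L₂)` for a merged, unreached exit, `w` itself for a merged and reached one,
`thR w = (n, n, n, k, k, k)` (`n` = admissible, `k` = invalid) for a separated, reached one — except when both exits
are separated in ONE sub-zone (edges `au`, `u′a` red, `uu′` blue), where the joint vector is `thR (w * w′)`
(`triCol`, `thetaTri`).  THE IDENTITY (`thetaTri_eq`): `thetaTri w w′ = 2 • ellv (w * w′) + ellv w * w′ +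
w * ellv w′ + α • e123 + β • e456` with `α = T₁T₂′ + T₂T₁′`, `β = I₁I₂′ + I₂I₁′`, `ellv w = ell (ψ w)`.
THEOREM (`thetaTri_InCone_of_invalidTypes`): if `w, w′ ∈ InCone` and every type state of both zones is
invalid (`T₁ = I₁`, `T₂ = I₂`), then `α = β` and `thetaTri w w′ ∈ InCone` — in particular for two
fugacity-deformed `(1,1)`-leaves `v a`, `v b` (`thetaTri_v_InCone`), hence (P) and the ZONE O-CUBE at the
output (`K4v_thetaTri_v`, `zoneOCube_thetaTri_v`).  Also `InCone.mul`: the cone is closed under the pointwise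
product.  The combinatorial meaning of `triCol` (the eight colourings) is C-041.md §21 (b); the reduction of every
two-exit cycle to this map is §21 (a).
-/

namespace PercRepro

namespace TreeClosure

open Finset

/-! ## The cone is closed under products -/

/-- A cone member times a pure vector is a cone member. -/
theorem InCone.mul_V {w : Vec6} (hw : InCone w) {m : ℕ} (a : Fin m → ℝ) (ha : ∀ i, 0 ≤ a i ∧ a i ≤ 1) :
    InCone (w * V a) := by
  unfold V
  have key : ∀ s : Finset (Fin m), InCone (w * ∏ i ∈ s, v (a i)) := by
    intro s
    induction s using Finset.induction_on with
    | empty => simpa using hw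
    | insert j s hj ih =>
      rw [Finset.prod_insert hj, mul_left_comm, mul_comm (v (a j))]
      exact ih.mul_v (ha j).1 (ha j).2
  exact key univ

/-- **The cone is closed under the pointwise product.** -/
theorem InCone.mul {w w' : Vec6} (hw : InCone w) (hw' : InCone w') : InCone (w * w') := by
  induction hw' with
  | pure a ha => exact hw.mul_V a ha
  | add hx hy ihx ihy => rw [mul_add]; exact ihx.add ihy
  | smul c hc hx ih => rw [mul_smul_comm]; exact ih.smul c hc

/-! ## The per-exit vectors and the triangle map -/

/-- `ℓ(ψ w)`: the six-vector of the zone `w` hung by one edge from an unmarked anchor. -/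
def ellv (w : Vec6) : Vec6 := ell (w 0) (w 1 - w 0) (w 2 - w 0) (w 4 + w 5 - w 3)

/-- `θ_B w`: a merged, unreached exit — every admissible state is counted by its class and is invalid. -/
def thB (w : Vec6) : Vec6 := ![w 0, w 1, w 2, w 0, w 1, w 2]

/-- `n w`: the admissible count `L₁ + L₂ − L₀`. -/
def nAdm (w : Vec6) : ℝ := w 1 + w 2 - w 0

/-- `k w`: the invalid count `M₁ + M₂ − M₀`. -/
def kInv (w : Vec6) : ℝ := w 4 + w 5 - w 3

/-- `θ_R w`: a separated, reached exit — a separate sub-zone with `n` admissible and `k` invalid states. -/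
def thR (w : Vec6) : Vec6 := ![nAdm w, nAdm w, nAdm w, kInv w, kInv w, kInv w]

/-- `ℓ(ψ w) = θ_B w + θ_R w`: hanging by an edge is «edge blue» plus «edge red». -/
theorem thB_add_thR (w : Vec6) : thB w + thR w = ellv w := by
  ext i
  fin_cases i <;> simp [thB, thR, ellv, ell, nAdm, kInv] <;> ring

/-- The contribution of the hanging zones `w` (at `u`) and `w′` (at `u′`) for one colouring of the triangle's
edges `au`, `uu′`, `u′a` (`true` = red), by the statuses of the exits (C-041.md §21 (b)). -/
def triCol (w w' : Vec6) : Bool → Bool → Bool → Vec6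
  | false, false, false => thB w * thB w'
  | false, false, true  => thB w * w'
  | true,  false, false => w * thB w'
  | true,  false, true  => thR (w * w')
  | false, true,  false => thB w * thB w'
  | false, true,  true  => w * thR w'
  | true,  true,  false => thR w * w'
  | true,  true,  true  => thR w * thR w'

/-- **The triangle map**: the sum over the eight edge colourings. -/
def thetaTri (w w' : Vec6) : Vec6 := ∑ e₁ : Bool, ∑ e₂ : Bool, ∑ e₃ : Bool, triCol w w' e₁ e₂ e₃

/-- The triangle map in closed form. -/
theorem thetaTri_eq_sum (w w' : Vec6) :
    thetaTri w w' = thB w * thB w' + thB w * thB w' + thR w * thR w' + ellv w * w' + w * ellv w'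
      + thR (w * w') := by
  unfold thetaTri
  simp only [Fintype.sum_bool, triCol]
  rw [← thB_add_thR w, ← thB_add_thR w']
  simp only [add_mul, mul_add]
  abel

/-- `e123 = (1,1,1,0,0,0)`: one valid state with no type. -/
def e123 : Vec6 := ![1, 1, 1, 0, 0, 0]

/-- `e456 = (0,0,0,1,1,1)`: one invalid state with no type. -/
def e456 : Vec6 := ![0, 0, 0, 1, 1, 1]

/-- `T₁ w`, `T₂ w`, `I₁ w`, `I₂ w`: the type counts and the invalid type counts. -/
def T1 (w : Vec6) : ℝ := w 1 - w 0
/-- type-2 count -/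
def T2 (w : Vec6) : ℝ := w 2 - w 0
/-- invalid type-1 count -/
def I1 (w : Vec6) : ℝ := w 4 - w 3
/-- invalid type-2 count -/
def I2 (w : Vec6) : ℝ := w 5 - w 3

/-- `θ_B` is multiplicative. -/
theorem thB_mul (w w' : Vec6) : thB (w * w') = thB w * thB w' := by
  ext i
  fin_cases i <;> simp [thB]

/-- Two separated reached exits in DIFFERENT sub-zones versus ONE sub-zone: the mixed-type states
`T₁T₂′ + T₂T₁′` (valid) and `I₁I₂′ + I₂I₁′` (invalid) are the difference. -/
theorem thR_mul_thR (w w' : Vec6) :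
    thR w * thR w' = thR (w * w') + (T1 w * T2 w' + T2 w * T1 w') • e123 + (I1 w * I2 w' + I2 w * I1 w') • e456 := by
  ext i
  fin_cases i <;> simp [thR, nAdm, kInv, e123, e456, T1, T2, I1, I2] <;> ring

/-- **THE TRIANGLE IDENTITY**: `θ_△(w, w′) = 2ℓ(ψ(ww′)) + ℓ(ψw)w′ + wℓ(ψw′) + (T₁T₂′ + T₂T₁′)e123 + (I₁I₂′ + I₂I₁′)e456`. -/
theorem thetaTri_eq (w w' : Vec6) :
    thetaTri w w' = (2 : ℝ) • ellv (w * w') + ellv w * w' + w * ellv w'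
      + (T1 w * T2 w' + T2 w * T1 w') • e123 + (I1 w * I2 w' + I2 w * I1 w') • e456 := by
  rw [thetaTri_eq_sum, thR_mul_thR, ← thB_mul, ← thB_add_thR (w * w'), two_smul]
  abel

/-! ## Cone membership when every type state is invalid -/

/-- **THEOREM (TRIANGLE, invalid-type inputs)**: if `w, w′` lie in the cone and every type state of both zones is
invalid (`T₁ = I₁`, `T₂ = I₂`), the triangle's six-vector lies in the cone. -/
theorem thetaTri_InCone_of_invalidTypes {w w' : Vec6} (hw : InCone w) (hw' : InCone w')
    (h1 : T1 w = I1 w) (h2 : T2 w = I2 w) (h1' : T1 w' = I1 w') (h2' : T2 w' = I2 w') :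
    InCone (thetaTri w w') := by
  have hK : K4v w := K4v_of_InCone hw
  have hK' : K4v w' := K4v_of_InCone hw'
  have hα : 0 ≤ T1 w * T2 w' + T2 w * T1 w' := by
    unfold K4v at hK hK'
    have := hK.t1_nonneg; have := hK.t2_nonneg; have := hK'.t1_nonneg; have := hK'.t2_nonneg
    unfold T1 T2
    positivity
  have e1 : e123 + e456 = (1 : Vec6) := by
    ext i
    fin_cases i <;> simp [e123, e456]
  have e : thetaTri w w' = (2 : ℝ) • ellv (w * w') + ellv w * w' + w * ellv w'
      + (T1 w * T2 w' + T2 w * T1 w') • (1 : Vec6) := by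
    rw [thetaTri_eq, ← h1, ← h2, ← h1', ← h2', add_assoc, ← smul_add, e1]
  rw [e]
  refine InCone.add (InCone.add (InCone.add ?_ ?_) ?_) (InCone.smul _ hα InCone_one)
  · refine InCone.smul 2 (by norm_num) ?_
    have := InCone_one.mul_ell (K4v_of_InCone (hw.mul hw'))
    simpa [ellv] using this
  · have := (InCone_one.mul_ell hK)
    rw [one_mul] at this
    exact this.mul hw'
  · exact hw.mul_ell hK'

/-- A fugacity-deformed `(1,1)`-leaf has every type state invalid: `T₁ = I₁ = a²`. -/
theorem T1_v_eq_I1 (a : ℝ) : T1 (v a) = I1 (v a) := by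
  simp [T1, I1, v]; ring

/-- `T₂ = I₂ = (1 − a)²` for the deformed leaf. -/
theorem T2_v_eq_I2 (a : ℝ) : T2 (v a) = I2 (v a) := by
  simp [T2, I2, v]; ring

/-- A single deformed leaf is a pure vector: `v a = V ![a]`. -/
theorem v_eq_V (a : ℝ) : v a = V ![a] := by
  unfold V
  rw [Fin.prod_univ_one]
  rfl

/-- A single deformed leaf lies in the cone. -/
theorem InCone_v (a : ℝ) (ha : 0 ≤ a ∧ a ≤ 1) : InCone (v a) := by
  rw [v_eq_V]
  exact InCone.pure ![a] (fun i => by fin_cases i; exact ha)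

/-- **THEOREM (TRIANGLE, one deformed leaf per exit)**: the triangle with deformed `(1,1)`-leaves `v a`, `v b` at its
two exits lies in the cone. -/
theorem thetaTri_v_InCone (a b : ℝ) (ha : 0 ≤ a ∧ a ≤ 1) (hb : 0 ≤ b ∧ b ≤ 1) :
    InCone (thetaTri (v a) (v b)) :=
  thetaTri_InCone_of_invalidTypes (InCone_v a ha) (InCone_v b hb) (T1_v_eq_I1 a) (T2_v_eq_I2 a)
    (T1_v_eq_I1 b) (T2_v_eq_I2 b)

/-- (P) at the output: `(F − I)² ≤ T₁ T₂` for the triangle with two deformed leaves. -/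
theorem K4v_thetaTri_v (a b : ℝ) (ha : 0 ≤ a ∧ a ≤ 1) (hb : 0 ≤ b ∧ b ≤ 1) :
    K4v (thetaTri (v a) (v b)) :=
  K4v_of_InCone (thetaTri_v_InCone a b ha hb)

/-- The ZONE O-CUBE at the output: `2F ≤ T₁ + T₂ + 2I` for the triangle with two deformed leaves. -/
theorem zoneOCube_thetaTri_v (a b : ℝ) (ha : 0 ≤ a ∧ a ≤ 1) (hb : 0 ≤ b ∧ b ≤ 1) :
    0 ≤ (thetaTri (v a) (v b) 1 - thetaTri (v a) (v b) 0) + (thetaTri (v a) (v b) 2 - thetaTri (v a) (v b) 0)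
      + 2 * (thetaTri (v a) (v b) 4 + thetaTri (v a) (v b) 5 - thetaTri (v a) (v b) 3)
      - 2 * thetaTri (v a) (v b) 0 :=
  zoneOCube_nonneg_of_K4 (K4v_thetaTri_v a b ha hb)

/-! ## The general form: cone membership whenever the mixed-type defect vanishes -/

/-- **THEOREM (TRIANGLE, α = β)**: if `w, w′` lie in the cone and the mixed-type defect vanishes,
`T₁T₂′ + T₂T₁′ = I₁I₂′ + I₂I₁′`, the triangle's six-vector lies in the cone. -/
theorem thetaTri_InCone_of_alpha_eq_beta {w w' : Vec6} (hw : InCone w) (hw' : InCone w')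
    (hαβ : T1 w * T2 w' + T2 w * T1 w' = I1 w * I2 w' + I2 w * I1 w') : InCone (thetaTri w w') := by
  have hK : K4v w := K4v_of_InCone hw
  have hK' : K4v w' := K4v_of_InCone hw'
  have hα : 0 ≤ T1 w * T2 w' + T2 w * T1 w' := by
    unfold K4v at hK hK'
    have := hK.t1_nonneg; have := hK.t2_nonneg; have := hK'.t1_nonneg; have := hK'.t2_nonneg
    unfold T1 T2
    positivity
  have e1 : e123 + e456 = (1 : Vec6) := by
    ext i
    fin_cases i <;> simp [e123, e456]
  have e : thetaTri w w' = (2 : ℝ) • ellv (w * w') + ellv w * w' + w * ellv w'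
      + (T1 w * T2 w' + T2 w * T1 w') • (1 : Vec6) := by
    rw [thetaTri_eq, ← hαβ, add_assoc, ← smul_add, e1]
  rw [e]
  refine InCone.add (InCone.add (InCone.add ?_ ?_) ?_) (InCone.smul _ hα InCone_one)
  · refine InCone.smul 2 (by norm_num) ?_
    have := InCone_one.mul_ell (K4v_of_InCone (hw.mul hw'))
    simpa [ellv] using this
  · have := (InCone_one.mul_ell hK)
    rw [one_mul] at this
    exact this.mul hw'
  · exact hw.mul_ell hK'

/-- A vertex with `p` marks of type 1 only is the pure vector `v 1 ^ p = (1, 2^p, 1, 0, 1, 0)`: no type-2 states. -/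
theorem T2_pow_v_one (p : ℕ) : T2 (v 1 ^ p) = 0 := by
  simp [T2, v]

/-- … and no invalid type-2 states. -/
theorem I2_pow_v_one (p : ℕ) : I2 (v 1 ^ p) = 0 := by
  simp [I2, v]

/-- A vertex with `q` marks of type 2 only is `v 0 ^ q = (1, 1, 2^q, 0, 0, 1)`: no type-1 states. -/
theorem T1_pow_v_zero (q : ℕ) : T1 (v 0 ^ q) = 0 := by
  simp [T1, v]

/-- … and no invalid type-1 states. -/
theorem I1_pow_v_zero (q : ℕ) : I1 (v 0 ^ q) = 0 := by
  simp [I1, v]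

/-- `v 1 ^ p` lies in the cone. -/
theorem InCone_pow_v_one (p : ℕ) : InCone (v 1 ^ p) := by
  have := InCone_one.mul_pow_v (x := 1) (by norm_num) (by norm_num) p
  simpa using this

/-- `v 0 ^ q` lies in the cone. -/
theorem InCone_pow_v_zero (q : ℕ) : InCone (v 0 ^ q) := by
  have := InCone_one.mul_pow_v (x := 0) (by norm_num) (by norm_num) q
  simpa using this

/-- **COROLLARY (TRIANGLE, marks of one type)**: two exits carrying `p` and `p′` marks of type 1 (any
multiplicities): the triangle lies in the cone. -/
theorem thetaTri_pow_one_InCone (p p' : ℕ) : InCone (thetaTri (v 1 ^ p) (v 1 ^ p')) :=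
  thetaTri_InCone_of_alpha_eq_beta (InCone_pow_v_one p) (InCone_pow_v_one p')
    (by rw [T2_pow_v_one, I2_pow_v_one, T2_pow_v_one, I2_pow_v_one]; ring)

/-- **COROLLARY (TRIANGLE, marks of one type)**: two exits carrying `q` and `q′` marks of type 2. -/
theorem thetaTri_pow_zero_InCone (q q' : ℕ) : InCone (thetaTri (v 0 ^ q) (v 0 ^ q')) :=
  thetaTri_InCone_of_alpha_eq_beta (InCone_pow_v_zero q) (InCone_pow_v_zero q')
    (by rw [T1_pow_v_zero, I1_pow_v_zero, T1_pow_v_zero, I1_pow_v_zero]; ring)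

end TreeClosure

end PercRepro
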